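import Summits.CriticalPhenomena.PercolationContinuityZ3.Theorems.PercNearOneGluingNoHeavyLowerTailAPLLevelC
import HarnessLib

/-!
# `NoHeavyLowerTail` (stmt-CriticalPhenomena-4575) — THE CLOSURE THRESHOLD, `PrW` form: for every `C ≥ 28/27` parallel composition at the three
# terminals preserves `E ≤ C`

Support file (prover prim-ineq-gen-8 gen 61; `--supports stmt-CriticalPhenomena-4575`; memo
run/shared/lean/prim/prim-ineq-gen-8/FINDING-gen61-SPTHEOREM.md §1(1e)).  No definitions, no named facts, no sorries.

* **`parallel_comp_le_C`** — weights in `[0,1]`, `D₁, D₂` disjoint edge sets glued only at `o, u, v`, `C ≥ 28/27`: if `(o; u, v)` satisfies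
  `(P(u,v ∈ C_o) − P(u ∈ C_o)P(v ∈ C_o))² ≤ C·P(u ∈ C_o)·P(v ∈ C_o)·P(u ∉ C_o, v ∈ C_u)` on `D₁` and on `D₂`, then on `D₁ ∪ D₂` (cells of the union by
  `glued_cell_*`, Harris at `o, u, v` by `PrW_harris_cl`, then `twoSided_comp_le_C` of `…APLLevelC`; the degenerate case via `comp_le_of_apex_joined`).
With `series_reduction` (any `C ≥ 1`): **the class `{E ≤ C}` of `(o; u, v)`-networks is closed under all series–parallel gluings iff `C ≥ 28/27`**
("only if": the balanced ladders of `sp_E_le_sharp`).  Hence `sup E` over everything glued from a family `𝒫` of prime pieces is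
`max(28/27, sup_𝒫 E)` — the general conjectures (`C* ≈ 1.18`, (★★₂) `E ≤ 2`) are statements about prime pieces. [this work]
-/

namespace Summit.CriticalPhenomena.PercolationContinuityZ3.Theorems

namespace APL

open Literature.Probability.Percolation Literature.Probability.Percolation.Gladkov Literature.Probability.Percolation.DecisionTree
open scoped Classical

variable {V : Type*} [Fintype V]

/-! ### Parallel composition at every level `C ≥ 28/27` (`PrW` form) -/

section Parallel

variable [DecidableEq V]

/-- **PARALLEL COMPOSITION PRESERVES `E ≤ C` FOR EVERY `C ≥ 28/27`.**  Let `D₁, D₂` be disjoint edge sets such that every vertex meeting both is one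
of `o, u, v` (weights in `[0,1]`).  If `(o; u, v)` satisfies `(P(u,v ∈ C_o) − P(u ∈ C_o)P(v ∈ C_o))² ≤ C·P(u ∈ C_o)·P(v ∈ C_o)·P(u ∉ C_o, v ∈ C_u)` on
`D₁` and on `D₂`, then also on `D₁ ∪ D₂`.  With `series_reduction` (`C ≥ 1`): `{E ≤ C}` is closed under all series–parallel gluings iff `C ≥ 28/27`
(the "if" here, the "only if" by `sp_E_le_sharp`). [this work] -/
theorem parallel_comp_le_C (C : ℝ) (hC : 28 / 27 ≤ C) (p : Sym2 V → ℝ) (hp0 : ∀ e, 0 ≤ p e) (hp1 : ∀ e, p e ≤ 1)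
    (D₁ D₂ : Finset (Sym2 V)) (hdisj : Disjoint D₁ D₂) (o u v : V)
    (hsep : ∀ x : V, (∃ e ∈ D₁, x ∈ e) → (∃ e ∈ D₂, x ∈ e) → (x = o ∨ x = u ∨ x = v))
    (hE₁ : (PrW D₁ p {K : Finset (Sym2 V) | u ∈ cl K o ∧ v ∈ cl K o}
        - PrW D₁ p {K : Finset (Sym2 V) | u ∈ cl K o} * PrW D₁ p {K : Finset (Sym2 V) | v ∈ cl K o}) ^ 2
        ≤ C * PrW D₁ p {K : Finset (Sym2 V) | u ∈ cl K o} * PrW D₁ p {K : Finset (Sym2 V) | v ∈ cl K o}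
          * PrW D₁ p {K : Finset (Sym2 V) | u ∉ cl K o ∧ v ∈ cl K u})
    (hE₂ : (PrW D₂ p {K : Finset (Sym2 V) | u ∈ cl K o ∧ v ∈ cl K o}
        - PrW D₂ p {K : Finset (Sym2 V) | u ∈ cl K o} * PrW D₂ p {K : Finset (Sym2 V) | v ∈ cl K o}) ^ 2
        ≤ C * PrW D₂ p {K : Finset (Sym2 V) | u ∈ cl K o} * PrW D₂ p {K : Finset (Sym2 V) | v ∈ cl K o}
          * PrW D₂ p {K : Finset (Sym2 V) | u ∉ cl K o ∧ v ∈ cl K u}) :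
    (PrW (D₁ ∪ D₂) p {K : Finset (Sym2 V) | u ∈ cl K o ∧ v ∈ cl K o}
        - PrW (D₁ ∪ D₂) p {K : Finset (Sym2 V) | u ∈ cl K o} * PrW (D₁ ∪ D₂) p {K : Finset (Sym2 V) | v ∈ cl K o}) ^ 2
      ≤ C * PrW (D₁ ∪ D₂) p {K : Finset (Sym2 V) | u ∈ cl K o} * PrW (D₁ ∪ D₂) p {K : Finset (Sym2 V) | v ∈ cl K o}
        * PrW (D₁ ∪ D₂) p {K : Finset (Sym2 V) | u ∉ cl K o ∧ v ∈ cl K u} := by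
  -- Harris at o, u, v for both pieces
  have hH₁ := PrW_harris_cl D₁ hp0 hp1 o u v
  have hU₁ := PrW_harris_cl D₁ hp0 hp1 u o v
  have hV₁ := PrW_harris_cl D₁ hp0 hp1 v o u
  have hH₂ := PrW_harris_cl D₂ hp0 hp1 o u v
  have hU₂ := PrW_harris_cl D₂ hp0 hp1 u o v
  have hV₂ := PrW_harris_cl D₂ hp0 hp1 v o u
  rw [conn_comm_eq p D₁ o u, pendant_split_bc' p D₁ o u v, both_comm_eq p D₁ o u v] at hU₁
  rw [conn_comm_eq p D₁ o v, conn_comm_eq p D₁ u v, pendant_split_bc' p D₁ o u v, both_comm_eq p D₁ o v u] at hV₁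
  rw [conn_comm_eq p D₂ o u, pendant_split_bc' p D₂ o u v, both_comm_eq p D₂ o u v] at hU₂
  rw [conn_comm_eq p D₂ o v, conn_comm_eq p D₂ u v, pendant_split_bc' p D₂ o u v, both_comm_eq p D₂ o v u] at hV₂
  have hsw₁ : PrW D₁ p {K : Finset (Sym2 V) | v ∈ cl K o ∧ u ∈ cl K o} = PrW D₁ p {K : Finset (Sym2 V) | u ∈ cl K o ∧ v ∈ cl K o} :=
    PrW_congr_set D₁ p fun K _ => by simp only [Set.mem_setOf_eq]; exact And.comm
  have hsw₂ : PrW D₂ p {K : Finset (Sym2 V) | v ∈ cl K o ∧ u ∈ cl K o} = PrW D₂ p {K : Finset (Sym2 V) | u ∈ cl K o ∧ v ∈ cl K o} :=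
    PrW_congr_set D₂ p fun K _ => by simp only [Set.mem_setOf_eq]; exact And.comm
  rw [hsw₁] at hV₁; rw [hsw₂] at hV₂
  -- everything in cells
  rw [conn_eq_cells_b p D₁ o u v, conn_eq_cells_c p D₁ o u v, m_event_eq_cell p D₁ o u v] at hE₁
  rw [conn_eq_cells_b p D₂ o u v, conn_eq_cells_c p D₂ o u v, m_event_eq_cell p D₂ o u v] at hE₂
  rw [conn_eq_cells_b p D₁ o u v, conn_eq_cells_c p D₁ o u v] at hH₁
  rw [conn_eq_cells_b p D₂ o u v, conn_eq_cells_c p D₂ o u v] at hH₂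
  rw [conn_eq_cells_b p D₁ o u v] at hU₁
  rw [conn_eq_cells_c p D₁ o u v] at hV₁
  rw [conn_eq_cells_b p D₂ o u v] at hU₂
  rw [conn_eq_cells_c p D₂ o u v] at hV₂
  rw [conn_eq_cells_b p (D₁ ∪ D₂) o u v, conn_eq_cells_c p (D₁ ∪ D₂) o u v, m_event_eq_cell p (D₁ ∪ D₂) o u v,
    glued_cell_ab p D₁ D₂ hdisj o u v hsep, glued_cell_ac p D₁ D₂ hdisj o u v hsep, glued_cell_bc p D₁ D₂ hdisj o u v hsep,
    glued_cell_three p D₁ D₂ hdisj o u v hsep]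
  set Z1 := PrW D₁ p {K : Finset (Sym2 V) | u ∉ cl K o ∧ v ∉ cl K o ∧ v ∉ cl K u} with hZ1
  set B1 := PrW D₁ p {K : Finset (Sym2 V) | u ∈ cl K o ∧ v ∉ cl K o} with hB1
  set A1 := PrW D₁ p {K : Finset (Sym2 V) | v ∈ cl K o ∧ u ∉ cl K o} with hA1
  set M1 := PrW D₁ p {K : Finset (Sym2 V) | u ∉ cl K o ∧ v ∉ cl K o ∧ v ∈ cl K u} with hM1
  set T1 := PrW D₁ p {K : Finset (Sym2 V) | u ∈ cl K o ∧ v ∈ cl K o} with hT1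
  set Z2 := PrW D₂ p {K : Finset (Sym2 V) | u ∉ cl K o ∧ v ∉ cl K o ∧ v ∉ cl K u} with hZ2
  set B2 := PrW D₂ p {K : Finset (Sym2 V) | u ∈ cl K o ∧ v ∉ cl K o} with hB2
  set A2 := PrW D₂ p {K : Finset (Sym2 V) | v ∈ cl K o ∧ u ∉ cl K o} with hA2
  set M2 := PrW D₂ p {K : Finset (Sym2 V) | u ∉ cl K o ∧ v ∉ cl K o ∧ v ∈ cl K u} with hM2
  set T2 := PrW D₂ p {K : Finset (Sym2 V) | u ∈ cl K o ∧ v ∈ cl K o} with hT2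
  have hZ1n : 0 ≤ Z1 := PrW_nonneg D₁ hp0 hp1 _
  have hB1n : 0 ≤ B1 := PrW_nonneg D₁ hp0 hp1 _
  have hA1n : 0 ≤ A1 := PrW_nonneg D₁ hp0 hp1 _
  have hM1n : 0 ≤ M1 := PrW_nonneg D₁ hp0 hp1 _
  have hT1n : 0 ≤ T1 := PrW_nonneg D₁ hp0 hp1 _
  have hZ2n : 0 ≤ Z2 := PrW_nonneg D₂ hp0 hp1 _
  have hB2n : 0 ≤ B2 := PrW_nonneg D₂ hp0 hp1 _
  have hA2n : 0 ≤ A2 := PrW_nonneg D₂ hp0 hp1 _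
  have hM2n : 0 ≤ M2 := PrW_nonneg D₂ hp0 hp1 _
  have hT2n : 0 ≤ T2 := PrW_nonneg D₂ hp0 hp1 _
  have hsum1 : Z1 + B1 + A1 + M1 + T1 = 1 := cells_sum_eq_one p D₁ o u v
  have hsum2 : Z2 + B2 + A2 + M2 + T2 = 1 := cells_sum_eq_one p D₂ o u v
  -- hypotheses in the cell format of file V
  have hHo1 : (T1 + B1) * (T1 + A1) ≤ T1 := by
    linarith [hH₁, show (T1 + B1) * (T1 + A1) = (B1 + T1) * (A1 + T1) by ring]
  have hHo2 : (T2 + B2) * (T2 + A2) ≤ T2 := by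
    linarith [hH₂, show (T2 + B2) * (T2 + A2) = (B2 + T2) * (A2 + T2) by ring]
  have hHu1 : (T1 + B1) * (M1 + T1) ≤ T1 := by
    linarith [hU₁, show (T1 + B1) * (M1 + T1) = (B1 + T1) * (M1 + T1) by ring]
  have hHu2 : (T2 + B2) * (M2 + T2) ≤ T2 := by
    linarith [hU₂, show (T2 + B2) * (M2 + T2) = (B2 + T2) * (M2 + T2) by ring]
  have hHv1 : (T1 + A1) * (M1 + T1) ≤ T1 := by
    linarith [hV₁, show (T1 + A1) * (M1 + T1) = (A1 + T1) * (M1 + T1) by ring]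
  have hHv2 : (T2 + A2) * (M2 + T2) ≤ T2 := by
    linarith [hV₂, show (T2 + A2) * (M2 + T2) = (A2 + T2) * (M2 + T2) by ring]
  have hE1' : (T1 - (T1 + B1) * (T1 + A1)) ^ 2 ≤ C * ((T1 + B1) * (T1 + A1)) * M1 := by
    have e1 : (T1 - (T1 + B1) * (T1 + A1)) ^ 2 = (T1 - (B1 + T1) * (A1 + T1)) ^ 2 := by ring
    have e2 : C * ((T1 + B1) * (T1 + A1)) * M1 = C * (B1 + T1) * (A1 + T1) * M1 := by ring
    rw [e1, e2]; exact hE₁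
  have hE2' : (T2 - (T2 + B2) * (T2 + A2)) ^ 2 ≤ C * ((T2 + B2) * (T2 + A2)) * M2 := by
    have e1 : (T2 - (T2 + B2) * (T2 + A2)) ^ 2 = (T2 - (B2 + T2) * (A2 + T2)) ^ 2 := by ring
    have e2 : C * ((T2 + B2) * (T2 + A2)) * M2 = C * (B2 + T2) * (A2 + T2) * M2 := by ring
    rw [e1, e2]; exact hE₂
  -- composite cells
  obtain ⟨zB, hzB⟩ : ∃ t : ℝ, t = Z1 * B2 + B1 * Z2 + B1 * B2 := ⟨_, rfl⟩
  obtain ⟨zA, hzA⟩ : ∃ t : ℝ, t = Z1 * A2 + A1 * Z2 + A1 * A2 := ⟨_, rfl⟩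
  obtain ⟨zm, hzm⟩ : ∃ t : ℝ, t = Z1 * M2 + M1 * Z2 + M1 * M2 := ⟨_, rfl⟩
  obtain ⟨zτ, hzτ⟩ : ∃ t : ℝ, t = T1 * (Z2 + B2 + A2 + M2 + T2) + (Z1 + B1 + A1 + M1) * T2 + B1 * (A2 + M2) + A1 * (B2 + M2) + M1 * (B2 + A2) :=
    ⟨_, rfl⟩
  have eτ : Z1 * T2 + B1 * A2 + B1 * M2 + B1 * T2 + A1 * B2 + A1 * M2 + A1 * T2 + M1 * B2 + M1 * A2 + M1 * T2 + T1 * Z2 + T1 * B2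
      + T1 * A2 + T1 * M2 + T1 * T2 = zτ := by rw [hzτ]; ring
  have eB : Z1 * B2 + B1 * Z2 + B1 * B2 = zB := by rw [hzB]
  have eA : Z1 * A2 + A1 * Z2 + A1 * A2 = zA := by rw [hzA]
  have em : Z1 * M2 + M1 * Z2 + M1 * M2 = zm := by rw [hzm]
  rw [eτ, eB, eA, em]
  have key : (zτ - (zτ + zB) * (zτ + zA)) ^ 2 ≤ C * ((zτ + zB) * (zτ + zA)) * zm := by
    have hC0 : (0 : ℝ) ≤ C := by linarith
    -- degenerate cases (an apex never isolated): the level-28/27 lemma gives κ_z² ≤ 0 since z_m = 0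
    have degen : Z1 + M1 = 0 ∨ Z2 + M2 = 0 → (zτ - (zτ + zB) * (zτ + zA)) ^ 2 ≤ C * ((zτ + zB) * (zτ + zA)) * zm := by
      intro hO
      have h := comp_le_of_apex_joined Z1 B1 A1 M1 T1 Z2 B2 A2 M2 T2 zB zA zm zτ hZ1n hB1n hA1n hM1n hT1n hsum1 hZ2n hB2n hA2n hM2n
        hT2n hsum2 hO hHo1 hHo2 hzB hzA hzm hzτ
      have hzm0 : zm = 0 := by
        rcases hO with hO | hO
        · have hZ : Z1 = 0 := by linarith
          have hM : M1 = 0 := by linarith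
          rw [hzm, hZ, hM]; ring
        · have hZ : Z2 = 0 := by linarith
          have hM : M2 = 0 := by linarith
          rw [hzm, hZ, hM]; ring
      rw [hzm0] at h ⊢
      simpa using h
    rcases (add_nonneg hZ1n hM1n).eq_or_lt with hO1 | hO1
    · exact degen (Or.inl hO1.symm)
    rcases (add_nonneg hZ2n hM2n).eq_or_lt with hO2 | hO2
    · exact degen (Or.inr hO2.symm)
    exact twoSided_comp_le_C C hC Z1 B1 A1 M1 T1 Z2 B2 A2 M2 T2 zB zA zm zτ hZ1n hB1n hA1n hM1n hT1n hsum1 hZ2n hB2n hA2n hM2n hT2n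
      hsum2 hO1 hO2 hHo1 hHu1 hHv1 hHo2 hHu2 hHv2 hE1' hE2' hzB hzA hzm hzτ
  have e1 : (zτ - (zB + zτ) * (zA + zτ)) ^ 2 = (zτ - (zτ + zB) * (zτ + zA)) ^ 2 := by ring
  have e2 : C * (zB + zτ) * (zA + zτ) * zm = C * ((zτ + zB) * (zτ + zA)) * zm := by ring
  rw [e1, e2]; exact key

end Parallel

end APL

end Summit.CriticalPhenomena.PercolationContinuityZ3.Theorems
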